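import Mathlib
import Summits.Ventures.HodgeRepro2.T5UnitaryThreeHecke

/-!
# The Cartan cells `K diag(ϖ^k, 1, ϖ^{-k}) K`, `k ≥ 0`, are pairwise distinct

Blind cell `pub-hodge-repro2`, seat p8 (gen 13), Tier-5 kernel support.  The Cartan decomposition
of `U(2,1)` (`T5CartanUnitaryThree`) writes every `g` as `k₁ · diag(ϖ^k, 1, ϖ^{-k}) · k₂`; the
spherical Hecke algebra is then spanned by the characteristic functions `T_k` of the double cosets
`K_U diag(ϖ^k, 1, ϖ^{-k}) K_U`, `k ≥ 0`, PROVIDED these double cosets are pairwise distinct — the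
«uniqueness» half of the Cartan decomposition, the indexing of `H(U(2,1), K_U)` by the dominant
cocharacters `k ∈ ℕ` that the Satake isomorphism takes for granted.  This file proves it through
a double-coset invariant, the set of DENOMINATORS CLEARED by a matrix:

* `Clears R d g` — `d * g i j` is `R`-integral for all `i, j`;
* `clears_mul_left_iff` / `clears_mul_right_iff` — the invariant is unchanged by left and right
  multiplication with elements of `GL_n(R)`;
* `isInteger_zpow_iff` — `ϖ^n` is integral iff `n ≥ 0` (`ϖ` irreducible in `R`, `E` its fraction
  field — the DVR case of the record);
* `clears_cell_iff` — `d` clears `diag(ϖ^k, 1, ϖ^{-k})` iff `d ϖ^{-k}` is integral;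
* `eq_of_cell_eq` / `eq_of_mem_doubleCoset` — **if `diag(ϖ^l, 1, ϖ^{-l}) = k₁ · diag(ϖ^k, 1, ϖ^{-k}) · k₂`
  with `k₁, k₂ ∈ GL₃(R)` then `k = l`** (`k, l ∈ ℕ`), in `GL₃(E)` and inside `U(J)` with
  `k₁, k₂ ∈ K_U`.

README §8(d): uses an L-value-free non-vanishing device: NO.
-/

namespace Summit.Ventures.HodgeRepro2.T5CartanCellsDistinct

open IsLocalization Matrix

section Clears

variable (R : Type*) {E : Type*} [CommRing R] [Field E] [Algebra R E] {ι : Type*} [Fintype ι]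
  [DecidableEq ι]

/-- `d` clears the denominators of `g`: every `d * g i j` is `R`-integral. -/
def Clears (d : E) (g : Matrix ι ι E) : Prop := ∀ i j, IsInteger R (d * g i j)

variable {R}

omit [Fintype ι] [DecidableEq ι] in
/-- Membership in the cleared-denominator set, unfolded. -/
theorem clears_iff (d : E) (g : Matrix ι ι E) :
    Clears R d g ↔ ∀ i j, IsInteger R (d * g i j) := Iff.rfl

omit [Fintype ι] [DecidableEq ι] in
/-- A finite sum of integral elements is integral. -/
theorem isInteger_sum {s : Finset ι} {f : ι → E} (hf : ∀ i ∈ s, IsInteger R (f i)) :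
    IsInteger R (∑ i ∈ s, f i) :=
  Subsemiring.sum_mem _ hf

omit [DecidableEq ι] in
/-- Left multiplication by an integral matrix preserves the cleared denominators. -/
theorem Clears.mul_left {d : E} {g : Matrix ι ι E} (h : Clears R d g) {k : Matrix ι ι E}
    (hk : ∀ i j, IsInteger R (k i j)) : Clears R d (k * g) := by
  intro i j
  rw [Matrix.mul_apply, Finset.mul_sum]
  refine isInteger_sum fun l _ => ?_
  rw [mul_left_comm]
  exact isInteger_mul (hk i l) (h l j)

omit [DecidableEq ι] in
/-- Right multiplication by an integral matrix preserves the cleared denominators. -/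
theorem Clears.mul_right {d : E} {g : Matrix ι ι E} (h : Clears R d g) {k : Matrix ι ι E}
    (hk : ∀ i j, IsInteger R (k i j)) : Clears R d (g * k) := by
  intro i j
  rw [Matrix.mul_apply, Finset.mul_sum]
  refine isInteger_sum fun l _ => ?_
  rw [← mul_assoc]
  exact isInteger_mul (h i l) (hk l j)

/-- The entries of a matrix in the image of `GL_n(R)` are integral. -/
theorem isInteger_apply_of_mem_range {k : GL ι E}
    (hk : k ∈ (Matrix.GeneralLinearGroup.map (algebraMap R E)).range) (i j : ι) :
    IsInteger R ((k : Matrix ι ι E) i j) := by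
  obtain ⟨k₀, rfl⟩ := hk
  exact ⟨k₀.val i j, rfl⟩

/-- **The cleared denominators are a left `GL_n(R)`-invariant.** -/
theorem clears_mul_left_iff (d : E) (g : Matrix ι ι E) {k : GL ι E}
    (hk : k ∈ (Matrix.GeneralLinearGroup.map (algebraMap R E)).range) :
    Clears R d ((k : Matrix ι ι E) * g) ↔ Clears R d g := by
  constructor
  · intro h
    have := h.mul_left (isInteger_apply_of_mem_range (Subgroup.inv_mem _ hk))
    rwa [← Matrix.mul_assoc, Units.inv_mul, Matrix.one_mul] at this
  · intro h
    exact h.mul_left (isInteger_apply_of_mem_range hk)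

/-- **The cleared denominators are a right `GL_n(R)`-invariant.** -/
theorem clears_mul_right_iff (d : E) (g : Matrix ι ι E) {k : GL ι E}
    (hk : k ∈ (Matrix.GeneralLinearGroup.map (algebraMap R E)).range) :
    Clears R d (g * (k : Matrix ι ι E)) ↔ Clears R d g := by
  constructor
  · intro h
    have := h.mul_right (isInteger_apply_of_mem_range (Subgroup.inv_mem _ hk))
    rwa [Matrix.mul_assoc, Units.mul_inv, Matrix.mul_one] at this
  · intro h
    exact h.mul_right (isInteger_apply_of_mem_range hk)

/-- The cleared denominators are a double-coset invariant. -/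
theorem clears_mul_mul_iff (d : E) (g : Matrix ι ι E) {k₁ k₂ : GL ι E}
    (hk₁ : k₁ ∈ (Matrix.GeneralLinearGroup.map (algebraMap R E)).range)
    (hk₂ : k₂ ∈ (Matrix.GeneralLinearGroup.map (algebraMap R E)).range) :
    Clears R d ((k₁ : Matrix ι ι E) * g * (k₂ : Matrix ι ι E)) ↔ Clears R d g := by
  rw [clears_mul_right_iff d _ hk₂, clears_mul_left_iff d g hk₁]

end Clears

section Uniformiser

variable {R E : Type*} [CommRing R] [Field E] [Algebra R E] [IsFractionRing R E]

omit [IsFractionRing R E] in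
/-- `ϖ^n` is integral for `n ≥ 0`. -/
theorem isInteger_pow (ϖ : R) (n : ℕ) : IsInteger R ((algebraMap R E ϖ) ^ n) :=
  ⟨ϖ ^ n, map_pow _ _ _⟩

/-- **A power `ϖ^n` (`n : ℤ`) of a uniformiser is integral iff `n ≥ 0`.** -/
theorem isInteger_zpow_iff {ϖ : R} (hϖ : Irreducible ϖ) (n : ℤ) :
    IsInteger R ((algebraMap R E ϖ) ^ n) ↔ 0 ≤ n := by
  have hne : algebraMap R E ϖ ≠ 0 :=
    (map_ne_zero_iff _ (IsFractionRing.injective R E)).mpr hϖ.ne_zero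
  constructor
  · intro h
    by_contra hn
    have hn' : n < 0 := not_le.mp hn
    obtain ⟨m, hm⟩ : ∃ m : ℕ, n = -((m + 1 : ℕ) : ℤ) := ⟨(-n - 1).toNat, by omega⟩
    rw [hm, _root_.zpow_neg, zpow_natCast, ← map_pow] at h
    have hu := T5UnitaryThreeCorner.isUnit_of_isInteger_inv (by rw [map_pow]; exact pow_ne_zero _ hne) h
    exact hϖ.not_isUnit ((isUnit_pow_iff (Nat.succ_ne_zero m)).mp hu)
  · intro hn
    obtain ⟨m, rfl⟩ := Int.eq_ofNat_of_zero_le hn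
    rw [zpow_natCast]
    exact isInteger_pow ϖ m

end Uniformiser

section Cells

variable {R E : Type*} [CommRing R] [Field E] [Algebra R E] [IsFractionRing R E]

/-- The uniformiser as a unit of `E`. -/
noncomputable def piUnit {ϖ : R} (hϖ : Irreducible ϖ) : Eˣ :=
  Units.mk0 (algebraMap R E ϖ) ((map_ne_zero_iff _ (IsFractionRing.injective R E)).mpr hϖ.ne_zero)

/-- The Cartan cell representative `diag(ϖ^k, 1, ϖ^{-k})` (`k : ℕ`), as in
`T5CartanUnitaryThree`. -/
noncomputable def cell {ϖ : R} (hϖ : Irreducible ϖ) (k : ℕ) : GL (Fin 3) E :=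
  T5CartanUniformiser.diagonalUnit fun i => (piUnit (E := E) hϖ) ^ (![(k : ℤ), 0, -k] i)

/-- The matrix of the cell representative. -/
theorem coe_cell {ϖ : R} (hϖ : Irreducible ϖ) (k : ℕ) :
    (cell (E := E) hϖ k : Matrix (Fin 3) (Fin 3) E) =
      !![(algebraMap R E ϖ) ^ (k : ℤ), 0, 0; 0, 1, 0; 0, 0, (algebraMap R E ϖ) ^ (-(k : ℤ))] := by
  rw [cell, T5HermitianThreeElements.coe_diagonalUnit_zpow_fin_three]
  simp only [piUnit, Units.val_zpow_eq_zpow_val, Units.val_mk0]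

/-- **`d` clears `diag(ϖ^k, 1, ϖ^{-k})` iff `d ϖ^{-k}` is integral.** -/
theorem clears_cell_iff {ϖ : R} (hϖ : Irreducible ϖ) (k : ℕ) (d : E) :
    Clears R d (cell (E := E) hϖ k : Matrix (Fin 3) (Fin 3) E) ↔
      IsInteger R (d * (algebraMap R E ϖ) ^ (-(k : ℤ))) := by
  rw [coe_cell]
  constructor
  · intro h
    simpa using h 2 2
  · intro h i j
    have hne : algebraMap R E ϖ ≠ 0 :=
      (map_ne_zero_iff _ (IsFractionRing.injective R E)).mpr hϖ.ne_zero
    have h' : IsInteger R (d * ((algebraMap R E ϖ) ^ k)⁻¹) := by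
      rwa [_root_.zpow_neg, zpow_natCast] at h
    have h0 : IsInteger R d := by
      have := isInteger_mul h' (isInteger_pow (E := E) ϖ k)
      rwa [mul_assoc, inv_mul_cancel₀ (pow_ne_zero _ hne), mul_one] at this
    have hk : IsInteger R (d * (algebraMap R E ϖ) ^ k) := by
      have := isInteger_mul h' (isInteger_pow (E := E) ϖ (k + k))
      rwa [mul_assoc, pow_add, inv_mul_cancel_left₀ (pow_ne_zero _ hne)] at this
    fin_cases i <;> fin_cases j <;> simp [h0, hk, h', isInteger_zero]

/-- `ϖ^l` clears the cell of `k` iff `k ≤ l`. -/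
theorem clears_pow_cell_iff {ϖ : R} (hϖ : Irreducible ϖ) (k l : ℕ) :
    Clears R ((algebraMap R E ϖ) ^ (l : ℤ)) (cell (E := E) hϖ k : Matrix (Fin 3) (Fin 3) E) ↔
      k ≤ l := by
  have hne : algebraMap R E ϖ ≠ 0 :=
    (map_ne_zero_iff _ (IsFractionRing.injective R E)).mpr hϖ.ne_zero
  rw [clears_cell_iff, ← zpow_add₀ hne, isInteger_zpow_iff hϖ]
  omega

/-- **Distinct Cartan cells**: if `diag(ϖ^l, 1, ϖ^{-l}) = k₁ · diag(ϖ^k, 1, ϖ^{-k}) · k₂` with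
`k₁, k₂ ∈ GL₃(R)`, then `k = l`. -/
theorem eq_of_cell_eq {ϖ : R} (hϖ : Irreducible ϖ) {k l : ℕ} {k₁ k₂ : GL (Fin 3) E}
    (hk₁ : k₁ ∈ (Matrix.GeneralLinearGroup.map (algebraMap R E)).range)
    (hk₂ : k₂ ∈ (Matrix.GeneralLinearGroup.map (algebraMap R E)).range)
    (h : cell (E := E) hϖ l = k₁ * cell hϖ k * k₂) : k = l := by
  have key : ∀ d : E, Clears R d (cell (E := E) hϖ l : Matrix (Fin 3) (Fin 3) E) ↔
      Clears R d (cell (E := E) hϖ k : Matrix (Fin 3) (Fin 3) E) := by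
    intro d
    rw [h, Units.val_mul, Units.val_mul, clears_mul_mul_iff d _ hk₁ hk₂]
  have h1 := (key ((algebraMap R E ϖ) ^ (l : ℤ))).mp ((clears_pow_cell_iff hϖ l l).mpr le_rfl)
  have h2 := (key ((algebraMap R E ϖ) ^ (k : ℤ))).mpr ((clears_pow_cell_iff hϖ k k).mpr le_rfl)
  rw [clears_pow_cell_iff] at h1 h2
  omega

end Cells

section Unitary

variable {R E : Type*} [CommRing R] [Field E] [StarRing E] [Algebra R E] [IsFractionRing R E]

/-- **Distinct Cartan cells inside `U(J)`**: for `k₁, k₂ ∈ K_U`, `a_l = k₁ a_k k₂` forces `k = l`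
(for cell representatives lying in `U(J)`). -/
theorem eq_of_mem_doubleCoset {ϖ : R} (hϖ : Irreducible ϖ) (J : Matrix (Fin 3) (Fin 3) E)
    {k l : ℕ} {k₁ k₂ : T5UnitaryGroupForm.formUnitaryGroup J}
    (hk₁ : k₁ ∈ T5UnitaryHeckeAdjoint.hyperspecialSubgroup R J)
    (hk₂ : k₂ ∈ T5UnitaryHeckeAdjoint.hyperspecialSubgroup R J)
    (h : cell (E := E) hϖ l = (k₁ : GL (Fin 3) E) * cell hϖ k * (k₂ : GL (Fin 3) E)) : k = l :=
  eq_of_cell_eq hϖ (Subgroup.mem_subgroupOf.mp hk₁) (Subgroup.mem_subgroupOf.mp hk₂) h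

end Unitary

end Summit.Ventures.HodgeRepro2.T5CartanCellsDistinct
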